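import Literature.Barriers.Parity.SiegelZeroQuadraticPolynomialsProp2Limit
import HarnessLib

/-!
# Granville–Mollin 2000, Proposition 2, from the explicit formula (3.3) and the sparsity of
# exceptional primes; the catalogued barrier from Theorem 4 and these two inputs

Topic `Literature/Barriers/Parity`, companion ("Proofs"-type, theorems only, everything PROVED) of
the catalogue entry `SiegelZeroQuadraticPolynomials.lean` (Granville–Mollin, *Rabinowitsch
revisited*, Acta Arith. 96 (2000)). Main results:

* `GranvilleMollin2000_prop2_of_eq33_of_prop35` — **Proposition 2** ("Suppose that there is a
  Siegel zero for `L(s, (d/·))` with `η → ∞` as `|d| → ∞`. Then `ϱ_d ∼ c_f / log(|d|^η)`"), in the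
  vendored form `Literature.Barriers.Parity.GranvilleMollin2000_prop2`, PROVED from the two named
  analytic inputs of `Literature/NumberTheory/LFunctions/ExceptionalZeroPrimeSums.lean`:
  Granville–Mollin's (3.3) (`GranvilleMollin2000_eq33`: the explicit formula for
  `θ(x; (d/·))` in the Linnik range with the exceptional term `−x^β/β`, from Davenport §19 and
  Bombieri's log-free density estimate with the Deuring–Heilbronn factor) and Tao–Teräväinen's
  Proposition 3.5 (`TaoTeravainen2021_prop35`: `∑_{q^{(1+ε)/2} < p* ≤ x} 1/p* ≪_ε (log_q x)/η`,
  which replaces the paper's (5.7) = (5.5) + Heath-Brown's Lemma 3 on the range `√q < p ≤ U`).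
  The proof is the §8 computation (`…Prop2Limit.lean`) with the parameters `M = 10(1 + 2K₁)/ε`,
  `U = q^{η/M}`, `V = q^{(1 + ε/40)/2}` and explicit thresholds `η₀`, `d₀`; for `d ≡ 1 (mod 8)`
  (`ω(2) = 2`) the partial products vanish identically, so `c_f = 0 = ϱ_d` and the statement is
  trivial, as in the source (where `f_d` then has the fixed prime divisor `2`).
* `SiegelZeroQuadraticPolynomials_of_thm4_of_eq33_of_prop35` — the catalogued conjunction
  `SiegelZeroQuadraticPolynomials = GranvilleMollin2000_thm4 ∧ GranvilleMollin2000_prop2` from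
  `GranvilleMollin2000_thm4` and the same two inputs. (Theorem 4 itself is the sieve argument of
  §6; its inputs are vendored in `SiegelZeroQuadraticPolynomialsInputs.lean`.)

Trust base of Proposition 2 after this file: `GranvilleMollin2000_eq33`, `TaoTeravainen2021_prop35`
(both consequences of the explicit formula / zero-density theory for `L(s, χ)`, not available in
Mathlib); everything else (Mertens' theorems with rates, `Ein = γ + log + E₁`, quadratic
reciprocity for `ω_{f_d}`, the partial summation) is proved in the tree.

[cite: GranvilleMollin2000, Proposition 2, §5C and §8] [cite: TaoTeravainen2021, Proposition 3.5]
-/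

noncomputable section

open Finset Real

namespace Literature.Barriers.Parity

open Literature.NumberTheory.LFunctions.SiegelZero (jacobiTheta)
open Literature.NumberTheory.Sieve (expIntegralE1 polyRootCountMod)

/-! ### The small terms (threshold bookkeeping for Proposition 2) -/

/-- `16/(⌊√q⌋ + 1) ≤ ε/10` once `q ≥ (160/ε)²`. [folklore] -/
theorem sixteen_div_floor_sqrt_le {ε : ℝ} {q : ℕ} (hε : 0 < ε) (hq : (160 / ε) ^ 2 ≤ (q : ℝ)) :
    16 / ((⌊Real.sqrt q⌋₊ : ℝ) + 1) ≤ ε / 10 := by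
  have hq0 : (0 : ℝ) ≤ q := by positivity
  have hsq : 160 / ε ≤ Real.sqrt q := by
    rw [Real.le_sqrt (by positivity) hq0]; exact hq
  have hs_gt : Real.sqrt q - 1 < (⌊Real.sqrt q⌋₊ : ℝ) := by
    have := Nat.lt_floor_add_one (Real.sqrt (q : ℝ))
    linarith
  have h160 : 160 / ε ≤ (⌊Real.sqrt q⌋₊ : ℝ) + 1 := by linarith
  have hpos : 0 < 160 / ε := by positivity
  calc 16 / ((⌊Real.sqrt q⌋₊ : ℝ) + 1) ≤ 16 / (160 / ε) :=
        div_le_div_of_nonneg_left (by norm_num) hpos h160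
    _ = ε / 10 := by field_simp; ring

/-- `8/log U ≤ ε/10` for `log U = (η/M) log q`, `log q ≥ 1`, `η ≥ 80M/ε`. [folklore] -/
theorem eight_div_log_le {ε η M L : ℝ} (hε : 0 < ε) (hM : 0 < M) (hL : 1 ≤ L)
    (hη : 80 * M / ε ≤ η) : 8 / (η / M * L) ≤ ε / 10 := by
  have h1 : 80 * M ≤ η * ε := by rwa [div_le_iff₀ hε] at hη
  have hη0 : 0 < η := lt_of_lt_of_le (by positivity) hη
  rw [div_le_iff₀ (by positivity),
    show ε / 10 * (η / M * L) = η * ε * L / (10 * M) by field_simp, le_div_iff₀ (by positivity)]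
  calc 8 * (10 * M) = 80 * M := by ring
    _ ≤ η * ε := h1
    _ = η * ε * 1 := by ring
    _ ≤ η * ε * L := mul_le_mul_of_nonneg_left hL (by positivity)

/-- The `U`-terms of the partial-summation error are `≤ ε/10`: with `A₁ = K/q`, `A₂ = K/η`,
`ν = c/log q`, `log U = (η/M) log q ≥ 1`, `U ≥ 1`, `q ≥ 60K/ε` and `η ≥ 20(K + 2KM/c)/ε`,
`A₁/log²U + A₂U^{−ν}/log U + 2A₁/log U + 2A₂U^{−ν}/(ν log U) ≤ 3K/q + (K + 2KM/c)/η ≤ ε/10`.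
[folklore] -/
theorem abelError_U_le {ε K c η M U L q : ℝ} (hε : 0 < ε) (hK : 0 ≤ K) (hc : 0 < c) (hη1 : 1 ≤ η)
    (hM : 0 < M) (hq0 : 0 < q) (hU1 : 1 ≤ U) (hL0 : 0 < L) (hlogU : Real.log U = η / M * L)
    (hlogU1 : 1 ≤ Real.log U) (hqK : 60 * K / ε ≤ q) (hη20 : 20 * (K + 2 * K * M / c) / ε ≤ η) :
    K / q / Real.log U ^ 2 + K / η * U ^ (-(c / L)) / Real.log U +
      (2 * (K / q) / Real.log U + 2 * (K / η) * U ^ (-(c / L)) / (c / L * Real.log U)) ≤ ε / 10 := by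
  have hη0 : 0 < η := by linarith
  have hUν : U ^ (-(c / L)) ≤ 1 :=
    Real.rpow_le_one_of_one_le_of_nonpos hU1 (by rw [neg_nonpos]; positivity)
  have hUν0 : 0 ≤ U ^ (-(c / L)) := Real.rpow_nonneg (by linarith) _
  have hlogU0 : 0 < Real.log U := by linarith
  have hνU : c / L * Real.log U = c * η / M := by
    rw [hlogU]; field_simp
  have t1 : K / q / Real.log U ^ 2 ≤ K / q := by
    refine div_le_self (by positivity) ?_
    nlinarith
  have t2 : K / η * U ^ (-(c / L)) / Real.log U ≤ K / η := by
    refine (div_le_self (by positivity) hlogU1).trans ?_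
    calc K / η * U ^ (-(c / L)) ≤ K / η * 1 := by gcongr
      _ = K / η := mul_one _
  have t3 : 2 * (K / q) / Real.log U ≤ 2 * (K / q) := div_le_self (by positivity) hlogU1
  have t4 : 2 * (K / η) * U ^ (-(c / L)) / (c / L * Real.log U) ≤ 2 * K * M / c / η := by
    rw [hνU]
    calc 2 * (K / η) * U ^ (-(c / L)) / (c * η / M)
        ≤ 2 * (K / η) * 1 / (c * η / M) := by gcongr
      _ = 2 * K * M / c / η * (1 / η) := by field_simp
      _ ≤ 2 * K * M / c / η * 1 := by
          refine mul_le_mul_of_nonneg_left ?_ (by positivity)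
          rw [div_le_one hη0]; exact hη1
      _ = 2 * K * M / c / η := mul_one _
  have hqK' : 3 * (K / q) ≤ ε / 20 := by
    rw [show 3 * (K / q) = 3 * K / q by ring, div_le_iff₀ hq0]
    have := (div_le_iff₀ hε).mp hqK
    nlinarith
  have hηK' : K / η + 2 * K * M / c / η ≤ ε / 20 := by
    rw [show K / η + 2 * K * M / c / η = (K + 2 * K * M / c) / η by ring, div_le_iff₀ hη0]
    have := (div_le_iff₀ hε).mp hη20
    nlinarith
  linarith only [t1, t2, t3, t4, hqK', hηK']

/-- **(3.3) in the form consumed by the partial summation**: from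
`|θ(t) + t^β/β| ≤ K (t/(q log t) + t^{1 − c/log q}/η)` to
`≤ (K⁺/q) t/log t + (K⁺/η) t^{1−c/log q}`, `K⁺ = max K 0`, for `t > 1`. [folklore] -/
theorem theta_bound_reshape {θ K q η c L t : ℝ} (ht : 1 < t) (hq : 0 < q) (hη : 0 < η)
    (h : |θ| ≤ K * (t / (q * Real.log t) + t ^ (1 - c / L) / η)) :
    |θ| ≤ max K 0 / q * t / Real.log t + max K 0 / η * t ^ (1 - c / L) := by
  have ht0 : 0 < t := by linarith
  have hlogt : 0 < Real.log t := Real.log_pos ht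
  have hpos : 0 ≤ t / (q * Real.log t) + t ^ (1 - c / L) / η := by positivity
  calc |θ| ≤ K * (t / (q * Real.log t) + t ^ (1 - c / L) / η) := h
    _ ≤ max K 0 * (t / (q * Real.log t) + t ^ (1 - c / L) / η) :=
        mul_le_mul_of_nonneg_right (le_max_left _ _) hpos
    _ = max K 0 / q * t / Real.log t + max K 0 / η * t ^ (1 - c / L) := by ring

/-! ### Proposition 2 -/

open Filter _root_.Topology in
/-- **Granville–Mollin 2000, Proposition 2, assembled from (3.3) and the sparsity of exceptional
primes** (`Literature.NumberTheory.LFunctions.SiegelZero.GranvilleMollin2000_eq33`,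
`Literature.NumberTheory.LFunctions.SiegelZero.TaoTeravainen2021_prop35`): the §8 argument —
Mertens' theorems, `ω(p) = 1 + (p/q)`, the sparsity of the primes with `(p/q) ≠ −1` up to
`U = q^{η/M}` (here Tao–Teräväinen's Proposition 3.5 replaces the paper's (5.7)), and partial
summation of `∑_{p > U} (p/q)/p` against the main term `−x^β/β` of the explicit formula (3.3),
which produces `E₁(1/M) = log M − γ + O(1/M)` and hence `c_f/ϱ_d ∼ e^γ log U · e^{−γ} M = η log|d|`.
For `d ≡ 1 (mod 8)` both sides vanish (`ω(2) = 2`). [cite: GranvilleMollin2000, Proposition 2 and §8] -/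
theorem GranvilleMollin2000_prop2_of_eq33_of_prop35
    (h33 : Literature.NumberTheory.LFunctions.SiegelZero.GranvilleMollin2000_eq33)
    (h35 : Literature.NumberTheory.LFunctions.SiegelZero.TaoTeravainen2021_prop35) :
    GranvilleMollin2000_prop2 := by
  intro ε hε
  -- reduce to `ε' = min ε 1`
  set ε' : ℝ := min ε 1 with hε'_def
  have hε' : 0 < ε' := lt_min hε one_pos
  have hε'1 : ε' ≤ 1 := min_le_right _ _
  have hε'ε : ε' ≤ ε := min_le_left _ _
  -- the analytic inputs: (3.3) with `C = 10`, Proposition 3.5 with `ε₁ = ε'/40`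
  obtain ⟨c, hc, K, η₁, q₁, H33⟩ := h33 10 (by norm_num)
  obtain ⟨K₁, η₂, q₂, H35⟩ := h35 (ε' / 40) (by positivity)
  set K' : ℝ := max K 0 with hK'_def
  set K₁' : ℝ := max K₁ 0 with hK₁'_def
  have hK' : 0 ≤ K' := le_max_right _ _
  have hK₁' : 0 ≤ K₁' := le_max_right _ _
  have hK₁K₁' : K₁ ≤ K₁' := le_max_left _ _
  -- the parameters `M`, `η₀`, `d₀`
  set M : ℝ := 10 * (1 + 2 * K₁') / ε' with hM_def
  have hM : 0 < M := by positivity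
  have hM1 : 1 ≤ M := by
    rw [hM_def, le_div_iff₀ hε']; nlinarith only [hε'1, hK₁']
  have hM_eq : (1 + 2 * K₁') / M = ε' / 10 := by
    rw [hM_def]; field_simp
  refine ⟨max η₁ 0 + max η₂ 0 + (10 * M + 1) + 80 * M / ε' + 20 * (K' + 2 * K' * M / c) / ε' + 2,
    max q₁ 0 + max q₂ 0 + Real.exp (2160 / ε') + 60 * K' / ε' + (160 / ε') ^ 2 + 16, ?_⟩
  intro d hd hdd q _ hq χ hχp hχq η hη hzero c₀ hc₀
  -- from `d` to `q`
  obtain ⟨hdneg, hdsq, hd4⟩ := hd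
  have hdq : d = -(q : ℤ) := by rw [abs_of_neg hdneg] at hq; omega
  have hq4 : q % 4 = 3 := by omega
  have hsqf : Squarefree q := by
    have h := Int.squarefree_natAbs.mpr hdsq
    rwa [show d.natAbs = q by rw [hdq]; simp] at h
  have habs : |(d : ℝ)| = q := by
    rw [hdq]; push_cast; rw [abs_neg, Nat.abs_cast]
  rw [habs] at hdd hzero ⊢
  -- the two cases `q ≡ 3, 7 (mod 8)`
  rcases (show q % 8 = 3 ∨ q % 8 = 7 by omega) with hq8 | hq8
  swap
  · -- `q ≡ 7 (mod 8)`: `ω(2) = 2`, the partial products vanish, `c₀ = 0 = ϱ_d`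
    have hev : ∀ᶠ X : ℕ in atTop,
        (0 : ℝ) = Literature.NumberTheory.Sieve.batemanHornPartial ![rabinowitschPoly d] X :=
      eventually_atTop.2 ⟨2, fun X hX => (batemanHornPartial_rabinowitsch_eq_zero hdq hq8 hX).symm⟩
    have hc0 : c₀ = 0 := tendsto_nhds_unique hc₀ (tendsto_const_nhds.congr' hev)
    have hϱ0 : gmRho d = 0 := gmRho_eq_zero hdq hq8 (by omega)
    rw [hc0, hϱ0]; simp
  -- `q ≡ 3 (mod 8)`. Unpack the thresholds on `q` …
  have h₁ : q₁ ≤ max q₁ 0 := le_max_left _ _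
  have h₁' : 0 ≤ max q₁ 0 := le_max_right _ _
  have h₂ : q₂ ≤ max q₂ 0 := le_max_left _ _
  have h₂' : 0 ≤ max q₂ 0 := le_max_right _ _
  have h₃ : 0 ≤ Real.exp (2160 / ε') := (Real.exp_pos _).le
  have h₄ : 0 ≤ 60 * K' / ε' := by positivity
  have h₅ : 0 ≤ (160 / ε') ^ 2 := by positivity
  have hq₁ : q₁ ≤ q := by linarith only [hdd, h₁, h₁', h₂', h₃, h₄, h₅]
  have hq₂ : q₂ ≤ q := by linarith only [hdd, h₂, h₁', h₂', h₃, h₄, h₅]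
  have hqexp : Real.exp (2160 / ε') ≤ q := by linarith only [hdd, h₁', h₂', h₃, h₄, h₅]
  have hqK : 60 * K' / ε' ≤ q := by linarith only [hdd, h₁', h₂', h₃, h₄, h₅]
  have hq160 : (160 / ε') ^ 2 ≤ q := by linarith only [hdd, h₁', h₂', h₃, h₄, h₅]
  have hq16r : (16 : ℝ) ≤ q := by linarith only [hdd, h₁', h₂', h₃, h₄, h₅]
  have hq16 : 16 ≤ q := by exact_mod_cast hq16r
  have hq0 : (0 : ℝ) < q := by linarith only [hq16r]
  have hq1 : (1 : ℝ) < q := by linarith only [hq16r]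
  have hL : 2160 / ε' ≤ Real.log q := by
    rw [Real.le_log_iff_exp_le hq0]; exact hqexp
  have hL2160 : 2160 ≤ Real.log q := by
    refine le_trans ?_ hL
    rw [le_div_iff₀ hε']; nlinarith only [hε'1, hε']
  have hL3 : 3 ≤ Real.log q := by linarith only [hL2160]
  have hL1 : 1 ≤ Real.log q := by linarith only [hL2160]
  have hL0 : 0 < Real.log q := by linarith only [hL2160]
  -- … and on `η`
  have g₁ : η₁ ≤ max η₁ 0 := le_max_left _ _
  have g₁' : 0 ≤ max η₁ 0 := le_max_right _ _
  have g₂ : η₂ ≤ max η₂ 0 := le_max_left _ _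
  have g₂' : 0 ≤ max η₂ 0 := le_max_right _ _
  have g₃ : 0 ≤ 80 * M / ε' := by positivity
  have g₄ : 0 ≤ 20 * (K' + 2 * K' * M / c) / ε' := by positivity
  have hη₁ : η₁ ≤ η := by linarith only [hη, g₁, g₁', g₂', g₃, g₄, hM]
  have hη₂ : η₂ ≤ η := by linarith only [hη, g₂, g₁', g₂', g₃, g₄, hM]
  have hηM10 : 10 * M < η := by linarith only [hη, g₁', g₂', g₃, g₄]
  have hη80 : 80 * M / ε' ≤ η := by linarith only [hη, g₁', g₂', g₃, g₄, hM]
  have hη20 : 20 * (K' + 2 * K' * M / c) / ε' ≤ η := by linarith only [hη, g₁', g₂', g₃, g₄, hM]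
  have hη1 : 1 ≤ η := by linarith only [hηM10, hM1]
  have hη0 : 0 < η := by linarith only [hη1]
  have hηq : 1 < η * Real.log q := by nlinarith only [hη1, hL3]
  have hηL : 0 < η * Real.log q := by positivity
  -- `U = q^{η/M}` and `V = q^{(1 + ε'/40)/2}`
  have hηM : 10 < η / M := by rw [lt_div_iff₀ hM]; linarith only [hηM10]
  have hU10 : (q : ℝ) ^ (10 : ℝ) < (q : ℝ) ^ (η / M) := Real.rpow_lt_rpow_of_exponent_lt hq1 hηM
  have hUq : (q : ℝ) ≤ (q : ℝ) ^ (η / M) := by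
    have h := Real.rpow_le_rpow_of_exponent_le hq1.le (show (1 : ℝ) ≤ η / M by linarith only [hηM])
    rwa [Real.rpow_one] at h
  have he3 : Real.exp 1 < 3 := lt_trans Real.exp_one_lt_d9 (by norm_num)
  have hUe : Real.exp 1 ≤ (q : ℝ) ^ (η / M) := by linarith only [he3, hq16r, hUq]
  have hU1 : 1 ≤ (q : ℝ) ^ (η / M) := by linarith only [hq16r, hUq]
  have hsqU : Real.sqrt q ≤ (q : ℝ) ^ (η / M) := by
    rw [Real.sqrt_eq_rpow]
    exact Real.rpow_le_rpow_of_exponent_le hq1.le (by linarith only [hηM])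
  have hVU : (q : ℝ) ^ ((1 + ε' / 40) / 2) ≤ (q : ℝ) ^ (η / M) :=
    Real.rpow_le_rpow_of_exponent_le hq1.le (by linarith only [hηM, hε'1])
  have hlogU : Real.log ((q : ℝ) ^ (η / M)) = η / M * Real.log q := Real.log_rpow hq0 _
  have hlogU1 : 1 ≤ Real.log ((q : ℝ) ^ (η / M)) := by
    rw [hlogU]
    have : (1 : ℝ) ≤ η / M := by linarith only [hηM]
    nlinarith only [this, hL1]
  -- (3.3) ⇒ the bound for `θ(t; (·/q))` on `[U, ∞)`
  have hθ : ∀ t : ℝ, (q : ℝ) ^ (η / M) ≤ t →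
      |jacobiTheta q t + t ^ (1 - 1 / (η * Real.log q)) / (1 - 1 / (η * Real.log q))| ≤
        K' / q * t / Real.log t + K' / η * t ^ (1 - c / Real.log q) := fun t ht =>
    theta_bound_reshape (by linarith only [hU1, ht, hq16r, hUq]) hq0 hη0
      (H33 q hsqf hq4 hq₁ χ hχp hχq η hη₁ hzero t (lt_of_lt_of_le hU10 ht))
  -- the limit form of §8
  have hν : 0 < c / Real.log q := by positivity
  obtain ⟨hc₀pos, hB⟩ := pos_and_abs_log_sub_log_gmRho_le hdq hq8 hq16 hM hη0 hηq rfl hUe hsqU hν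
    (by positivity : 0 ≤ K' / q) (by positivity : 0 ≤ K' / η) hθ hc₀
  -- Proposition 3.5 ⇒ the bound for the head sum
  have hT : K₁ * (Real.log ((q : ℝ) ^ (η / M)) / Real.log q) / η ≤ K₁' / M := by
    have h1 : Real.log ((q : ℝ) ^ (η / M)) / Real.log q = η / M := by
      rw [hlogU]; field_simp
    rw [h1, show K₁ * (η / M) / η = K₁ / M by field_simp]
    exact div_le_div_of_nonneg_right hK₁K₁' hM.le
  have hH := sum_omega_div_sqrt_U_le hdq hq4 hL3 (ε₁ := ε' / 40) (by positivity)
    (by linarith only [hε'1, hε']) rfl hVU ((H35 q hsqf hq4 hq₂ χ hχp hχq η hη₂ hzero _ hVU).trans hT)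
  -- the small terms
  have hi := sixteen_div_floor_sqrt_le hε' hq160
  have hii : 108 / Real.log q ≤ ε' / 20 := by
    rw [div_le_iff₀ hL0]
    have := (div_le_iff₀ hε').mp hL
    nlinarith only [this, hε']
  have hiii : 8 / Real.log ((q : ℝ) ^ (η / M)) ≤ ε' / 10 := by
    rw [hlogU]; exact eight_div_log_le hε' hM hL1 hη80
  have hiv := abelError_U_le hε' hK' hc hη1 hM hq0 hU1 hL0 hlogU hlogU1 hqK hη20
  have hM' : 2 * (K₁' / M) + 1 / M = ε' / 10 := by rw [← hM_eq]; ring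
  -- conclusion: `|log c₀ − log(ϱ η log q)| ≤ ε'/2`, then exponentiate
  have hϱ : 0 < gmRho d := gmRho_pos hdq hq8
  have hB' : |Real.log (gmRho d) - Real.log (c₀ / (η * Real.log q))| ≤ ε' / 2 := by
    have h : |Real.log c₀ - Real.log (gmRho d * (η * Real.log q))| ≤ ε' / 2 := by
      refine hB.trans ?_
      linarith only [hH, hi, hii, hiii, hiv, hM']
    rw [Real.log_mul hϱ.ne' hηL.ne'] at h
    rw [Real.log_div hc₀pos.ne' hηL.ne', abs_sub_comm]
    convert h using 2
    ring
  exact abs_sub_le_mul_of_abs_log_sub_le hϱ (by positivity) (by linarith only [hε'1])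
    (by linarith only [hε'ε]) hB'

/-- **The catalogued barrier from Theorem 4 and the two analytic inputs of Proposition 2**:
`SiegelZeroQuadraticPolynomials` (= Theorem 4 ∧ Proposition 2) follows from the named facts
`GranvilleMollin2000_thm4`, `GranvilleMollin2000_eq33` and `TaoTeravainen2021_prop35`.
[cite: GranvilleMollin2000, Theorem 4 and Proposition 2] -/
theorem SiegelZeroQuadraticPolynomials_of_thm4_of_eq33_of_prop35 (h4 : GranvilleMollin2000_thm4)
    (h33 : Literature.NumberTheory.LFunctions.SiegelZero.GranvilleMollin2000_eq33)
    (h35 : Literature.NumberTheory.LFunctions.SiegelZero.TaoTeravainen2021_prop35) :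
    SiegelZeroQuadraticPolynomials :=
  ⟨h4, GranvilleMollin2000_prop2_of_eq33_of_prop35 h33 h35⟩

end Literature.Barriers.Parity
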